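import Summits.QuantumFields.QCD.Theses.SpectralDefectExtinction
import Literature.MathematicalPhysics.QuantumFieldTheory.QCDTimeReflection

/-!
# Sketch — crux-ideate round 1, ideator 2, crux stmt-QuantumFields-18064 `ExtinctionBuildsQCD` (SD⁺ → THR)

Card `block-away-the-sign` (Ideas/block-away-the-sign.md). Contents:

* §0 the crux unbundled (`SDPlus`, `THR`, `crux_iff` by `Iff.rfl`);
* §1 the OCCAM SANDWICH: modulo the shared named node `RobustYangMillsRG` (stmt-QuantumFields-14958) the bridge is
  implied by HeavyThresholdYMBridge's `ConstructiveDecouplingRG` (stmt-14667) — pure logic, PROVED — so a line on this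
  crux through 14958 must make SD⁺ load-bearing where 14667 pays with a dislocation large-deviation bound;
* §2 the fibrewise-majority positivity schema (PROVED): a signed weight `σ·ρ` whose defect mass fraction is `≤ θ`
  integrates to `≥ (1 − 2θ)∫ρ` — margin `½`, no rarity needed;
* §3 FIRST LEMMA of the line (sorried, provable-now from landed toolkits): the sign half of EXTINCT at the scheme's own
  side gives positivity of the HONEST signed partition function eventually in `k` — the `0 < ∫ w` admissibility clause
  of `RobustYangMillsRG` at `S = L_k`;
* §4 boundary conditions (stub S6): antiperiodic quarks = periodic quarks in a uniformly `e^{iπ/N_t}`-twisted field, an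
  operator perturbation of norm `≤ 2π/N_t`; Weyl comparison of the index, and "an antiperiodic sign defect forces a periodic
  EXTINCT defect" once `N_t · c a_k m/Z_k > 2π` (both sorried, M-sized).
-/

namespace Summit.QuantumFields.QCD.Cruxes.ExtinctionBuildsQCD.Ideator2R1

open scoped BigOperators Topology Classical MeasureTheory Matrix
open Filter MeasureTheory Matrix
open Literature.MathematicalPhysics.QuantumLattice Literature.MathematicalPhysics.QuantumFieldTheory
  Literature.Probability.LatticeModels
open Summit.QuantumFields.QCD.Theses.SpectralDefectExtinction

noncomputable section

/-! ## §0 The restated crux, unbundled -/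

/-- The conclusion of the bridge at `N_f`: massive QCD above a threshold (verbatim). -/
def THR (Nf : ℕ) : Prop :=
  ∃ reg : QCDRegularisation Nf, reg.HasMassScaling ∧ ∃ M₁ : ℝ, 0 ≤ M₁ ∧ ∀ m : Fin Nf → ℝ, (∀ f, M₁ < m f) →
    ∃ (z shift : QCDField Nf → ℕ → ℝ) (T : OSData (QCDField Nf) 4), IsQCDAlong (reg.scheme m z shift) T ∧
      T.IsNontrivial QCDField.glue ∧ T.IsNonGaussian QCDField.glue ∧
        (∀ f g : Fin Nf, f ≠ g → T.IsNontrivial (QCDField.pseudoRe f g)) ∧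
          ∃ Δ > 0, T.HasMassGap Δ ∧ (reg.scheme m z shift).HasLatticeMassGap Δ

/-- EXTINCT (verbatim clause of SD⁺) for witness data `(reg, c)` at the tuple `m`. -/
def Extinct (Nf : ℕ) (reg : QCDRegularisation Nf) (c : ℝ) (m : Fin Nf → ℝ) : Prop :=
  ∀ ε : ℝ, 0 < ε → ∀ᶠ k : ℕ in Filter.atTop, ∀ S : ℕ, reg.L k ≤ S → (∫ U, ((∑ f : Fin Nf, ((Multiset.countP (fun z : ℂ => z.im = 0 ∧ z.re < -(reg.mcrit k + reg.a k * m f / reg.Zm k)) (wilsonDirac (fundamentalRep (Fin 3)) U 0 1).charpoly.roots : ℝ) + (Multiset.countP (fun z : ℂ => |z.re| < c * (reg.a k * m f / reg.Zm k)) (spinorLift gammaFive * wilsonDirac (fundamentalRep (Fin 3)) U (reg.mcrit k + reg.a k * m f / reg.Zm k) 1).charpoly.roots : ℝ)))) * ∏ f : Fin Nf, ‖fermionDet (wilsonDirac (fundamentalRep (Fin 3)) U (reg.mcrit k + reg.a k * m f / reg.Zm k) 1)‖ ∂(wilsonMeasure (d := 4) (L := 2 * S + 1) (fundamentalRep (Fin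 3)) (reg.β k))) / (∫ U, ∏ f : Fin Nf, ‖fermionDet (wilsonDirac (fundamentalRep (Fin 3)) U (reg.mcrit k + reg.a k * m f / reg.Zm k) 1)‖ ∂(wilsonMeasure (d := 4) (L := 2 * S + 1) (fundamentalRep (Fin 3)) (reg.β k))) ≤ ε * ((2 * S + 1 : ℝ) / (2 * reg.L k + 1)) ^ 4

/-- TIGHT⁺ (verbatim clause of SD⁺, the extensive pin). -/
def TightPlus (Nf : ℕ) (reg : QCDRegularisation Nf) (M₀ : ℝ) (m : Fin Nf → ℝ) : Prop :=
  ∃ η : ℝ, 0 < η ∧ ∀ M : ℝ, M₀ < M → ∀ᶠ k : ℕ in Filter.atTop, max 1 (η * (reg.a k * (2 * reg.L k + 1 : ℝ)) ^ 2) ≤ (∫ U, (|(Multiset.countP (fun z : ℂ => z.re < 0) (spinorLift gammaFive * wilsonDirac (fundamentalRep (Fin 3)) U (reg.mcrit k - reg.a k * M / reg.Zm k) 1).charpoly.roots : ℝ) - 6 * (2 * reg.L k + 1 : ℝ) ^ 4|) * ∏ f : Fin Nf, ‖fermionDet (wilsonDirac (fundamentalRep (Fin 3)) U (reg.mcrit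 k + reg.a k * m f / reg.Zm k) 1)‖ ∂(wilsonMeasure (d := 4) (L := 2 * reg.L k + 1) (fundamentalRep (Fin 3)) (reg.β k))) / (∫ U, ∏ f : Fin Nf, ‖fermionDet (wilsonDirac (fundamentalRep (Fin 3)) U (reg.mcrit k + reg.a k * m f / reg.Zm k) 1)‖ ∂(wilsonMeasure (d := 4) (L := 2 * reg.L k + 1) (fundamentalRep (Fin 3)) (reg.β k)))

/-- SD⁺(N_f): the hypothesis of the restated bridge (= body of the restated `WindowExtinction` at `N_f`). -/
def SDPlus (Nf : ℕ) : Prop :=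
  ∃ reg : QCDRegularisation Nf, reg.HasMassScaling ∧ (reg.scheme 0 0 0).HasAsymptoticScaling ∧
    (∃ p : ℕ, ∀ᶠ k : ℕ in Filter.atTop, (reg.L k : ℝ) ≤ (reg.a k)⁻¹ ^ p) ∧ (∀ᶠ k : ℕ in Filter.atTop, -1 < reg.mcrit k) ∧
      ∃ M₀ : ℝ, 0 ≤ M₀ ∧ ∃ c : ℝ, 0 < c ∧ ∀ m : Fin Nf → ℝ, (∀ f, M₀ < m f) →
        Extinct Nf reg c m ∧ TightPlus Nf reg M₀ m

/-- The restated crux is `∀ N_f ∈ {2,3}, SD⁺(N_f) → THR(N_f)` (definitional). -/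
theorem crux_iff : ExtinctionBuildsQCD ↔ ∀ Nf : ℕ, (Nf = 2 ∨ Nf = 3) → SDPlus Nf → THR Nf := Iff.rfl

/-! ## §1 The Occam sandwich: modulo `RobustYangMillsRG` the bridge is below `ConstructiveDecouplingRG`

PUBLISHED VARIANT WITHOUT `import Summits.QuantumFields.QCD.Theses.HeavyThresholdYMBridge` (the crux-write verifier reported
`remote:incoherent:…HeavyThresholdYMBridge:mismatch` throughout this session; the by-name version — `of_thresholdQCD (h :
HeavyThresholdYMBridge.ThresholdQCD)` and `of_robustYM_of_constructiveDecoupling (hR : RobustYangMillsRG)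
(hC : ConstructiveDecouplingRG)`, farm `lean check` rc 0 — is attached to the item as evidence `Sketch-ideator2-18064.lean`).
Here `ThresholdQCD'` is the VERBATIM body of `HeavyThresholdYMBridge.ThresholdQCD` (stmt-8794) and the robust-YM node is an
abstract `R : Prop` (stmt-14958 `RobustYangMillsRG` is too long to restate; `ConstructiveDecouplingRG := RobustYangMillsRG →
ThresholdQCD`, stmt-14667). -/

/-- Verbatim body of `Summit.QuantumFields.QCD.Theses.HeavyThresholdYMBridge.ThresholdQCD` (stmt-QuantumFields-8794). -/
def ThresholdQCD' : Prop :=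
  ∀ Nf : ℕ, Nf = 2 ∨ Nf = 3 → ∃ M₀ : ℝ, 0 ≤ M₀ ∧ ∃ reg : QCDRegularisation Nf, reg.HasMassScaling ∧ ∀ m : Fin Nf → ℝ,
    (∀ f, M₀ < m f) → ∃ (z shift : QCDField Nf → ℕ → ℝ) (T : OSData (QCDField Nf) 4), IsQCDAlong (reg.scheme m z shift) T ∧
      T.IsNontrivial QCDField.glue ∧ T.IsNonGaussian QCDField.glue ∧
        (∀ f g : Fin Nf, f ≠ g → T.IsNontrivial (QCDField.pseudoRe f g)) ∧
          ∃ Δ > 0, T.HasMassGap Δ ∧ (reg.scheme m z shift).HasLatticeMassGap Δ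

/-- `ThresholdQCD` implies the bridge outright (SD⁺ unused): the bridge's conclusion is `ThresholdQCD` at `N_f` with the two
leading existentials swapped. -/
theorem of_thresholdQCD (h : ThresholdQCD') : ExtinctionBuildsQCD := by
  intro Nf hNf _
  obtain ⟨M₀, hM₀, reg, hms, hbody⟩ := h Nf hNf
  exact ⟨reg, hms, M₀, hM₀, hbody⟩

/-- **Occam sandwich (abstract in the robust-YM node `R`).** With `R := RobustYangMillsRG` (stmt-14958) and
`hC := ConstructiveDecouplingRG` (stmt-14667, `RobustYangMillsRG → ThresholdQCD`): `R → (R → ThresholdQCD) → ExtinctionBuildsQCD`.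
A line on THIS crux through 14958 is therefore contentful only where SD⁺ discharges something 14667 must otherwise prove —
the annealed dislocation / sign-defect bound, i.e. EXTINCT (card `block-away-the-sign`). -/
theorem of_robustYM_of_constructiveDecoupling {R : Prop} (hR : R) (hC : R → ThresholdQCD') :
    ExtinctionBuildsQCD :=
  of_thresholdQCD (hC hR)

/-! ## §2 Fibrewise majority: a signed weight with a defect MINORITY integrates positively (margin ½, no rarity) -/

/-- If the sign-defective part of a non-negative weight `ρ` carries at most the fraction `θ` of its mass, the signed
weight `σ·ρ` (`σ = ±1`) has integral `≥ (1 − 2θ)·∫ρ`. Applied fibre by fibre (block field `V` fixed, fine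
fluctuations integrated) this is the positivity-with-margin of the blocked HONEST sea weight on smooth block fields that
Bałaban's exp-format (`RobustYangMillsRG`'s `W`, norm `B₀ = O(1)` allowed) needs: a conditional MAJORITY, not rarity. -/
theorem integral_signed_ge_of_defectFraction {α : Type*} [MeasurableSpace α] (μ : Measure α)
    (ρ σ : α → ℝ) (θ : ℝ) (hρ : ∀ x, 0 ≤ ρ x) (hσ : ∀ x, σ x = 1 ∨ σ x = -1)
    (hρi : Integrable ρ μ) (hσm : Measurable fun x => σ x)
    (hdef : ∫ x, (if σ x = -1 then ρ x else 0) ∂μ ≤ θ * ∫ x, ρ x ∂μ) :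
    (1 - 2 * θ) * ∫ x, ρ x ∂μ ≤ ∫ x, σ x * ρ x ∂μ := by
  have hpt : ∀ x, σ x * ρ x = ρ x - 2 * (if σ x = -1 then ρ x else 0) := by
    intro x
    rcases hσ x with h | h
    · rw [h, if_neg (by norm_num)]; ring
    · rw [h, if_pos rfl]; ring
  have hdi : Integrable (fun x => if σ x = -1 then ρ x else 0) μ := by
    have : (fun x => if σ x = -1 then ρ x else 0) = Set.indicator {x | σ x = -1} ρ := by
      funext x; simp [Set.indicator_apply]
    rw [this]
    exact hρi.indicator (hσm (measurableSet_singleton (-1 : ℝ)))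
  have hsplit : ∫ x, σ x * ρ x ∂μ = ∫ x, ρ x ∂μ - 2 * ∫ x, (if σ x = -1 then ρ x else 0) ∂μ := by
    simp_rw [hpt]
    rw [integral_sub hρi (hdi.const_mul 2), integral_const_mul]
  have h0 : 0 ≤ ∫ x, ρ x ∂μ := integral_nonneg (fun x => hρ x)
  rw [hsplit]
  nlinarith [hdef, h0]

/-! ## §3 FIRST LEMMA of the line: the honest partition function is positive at the scheme's own side -/

/-- **First lemma (`honestPartition_pos_of_extinct`, provable-now).** If the SIGN half of EXTINCT holds at the scheme's
own side `2L_k+1` for the tuple `m` (phase-quenched expected number of real eigenvalues of `D_W(U,0,1)` below every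
`−m_f(k)` tends to `0`), then the honest signed partition function `∫ e^{−β_kS_W} ∏_f det D_W(U, m_f(k))` is
eventually POSITIVE — the `0 < ∫ w` admissibility clause of `RobustYangMillsRG` for the sea weight at `S = L_k`.
Route to proof (landed toolkits): on the clean event `det D_W(U,m_f(k),1)` is real `> 0` for every flavour
(`fermionDet_re_pos_of_clean`, p90243), the determinants are real (tree `WilsonDeterminantSign`), defects are
`ℕ`-valued so `P₊(defect) ≤ E₊[count] ≤ ε` (Markov), hence `∫∏det ≥ (1 − 2ε)∫∏|det| > 0` by §2. -/
theorem honestPartition_pos_of_extinct {Nf : ℕ} (reg : QCDRegularisation Nf) (m : Fin Nf → ℝ)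
    (hE : ∀ ε : ℝ, 0 < ε → ∀ᶠ k : ℕ in atTop,
      (∫ U, (∑ f : Fin Nf, (Multiset.countP (fun z : ℂ => z.im = 0 ∧ z.re < -(reg.mcrit k + reg.a k * m f / reg.Zm k))
          (wilsonDirac (fundamentalRep (Fin 3)) U 0 1).charpoly.roots : ℝ)) *
          ∏ f : Fin Nf, ‖fermionDet (wilsonDirac (fundamentalRep (Fin 3)) U (reg.mcrit k + reg.a k * m f / reg.Zm k) 1)‖
        ∂(wilsonMeasure (d := 4) (L := 2 * reg.L k + 1) (fundamentalRep (Fin 3)) (reg.β k))) /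
      (∫ U, ∏ f : Fin Nf, ‖fermionDet (wilsonDirac (fundamentalRep (Fin 3)) U (reg.mcrit k + reg.a k * m f / reg.Zm k) 1)‖
        ∂(wilsonMeasure (d := 4) (L := 2 * reg.L k + 1) (fundamentalRep (Fin 3)) (reg.β k))) ≤ ε) :
    ∀ᶠ k : ℕ in atTop,
      0 < ∫ U, (∏ f : Fin Nf, fermionDet (wilsonDirac (fundamentalRep (Fin 3)) U (reg.mcrit k + reg.a k * m f / reg.Zm k) 1)).re
        ∂(wilsonMeasure (d := 4) (L := 2 * reg.L k + 1) (fundamentalRep (Fin 3)) (reg.β k)) := by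
  sorry

/-- The sign half of EXTINCT at the scheme's own side is a projection of `Extinct` (instance `S = L_k`, volume ratio
`1`, summand dropped) — so the first lemma consumes the crux's hypothesis verbatim. -/
theorem signHalf_of_extinct {Nf : ℕ} (reg : QCDRegularisation Nf) (c : ℝ) (m : Fin Nf → ℝ)
    (h : Extinct Nf reg c m) :
    ∀ ε : ℝ, 0 < ε → ∀ᶠ k : ℕ in atTop,
      (∫ U, (∑ f : Fin Nf, (Multiset.countP (fun z : ℂ => z.im = 0 ∧ z.re < -(reg.mcrit k + reg.a k * m f / reg.Zm k))
          (wilsonDirac (fundamentalRep (Fin 3)) U 0 1).charpoly.roots : ℝ)) *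
          ∏ f : Fin Nf, ‖fermionDet (wilsonDirac (fundamentalRep (Fin 3)) U (reg.mcrit k + reg.a k * m f / reg.Zm k) 1)‖
        ∂(wilsonMeasure (d := 4) (L := 2 * reg.L k + 1) (fundamentalRep (Fin 3)) (reg.β k))) /
      (∫ U, ∏ f : Fin Nf, ‖fermionDet (wilsonDirac (fundamentalRep (Fin 3)) U (reg.mcrit k + reg.a k * m f / reg.Zm k) 1)‖
        ∂(wilsonMeasure (d := 4) (L := 2 * reg.L k + 1) (fundamentalRep (Fin 3)) (reg.β k))) ≤ ε := by
  sorry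

/-! ## §4 Boundary conditions (stub S6 input): antiperiodic quarks are a `2π/N_t`-perturbation of periodic ones

The tree's `wilsonDirac` is time-PERIODIC; every RP/format-based node (14958, 14667, 18065) lives on ANTIPERIODIC quarks
(`wilsonDiracAP`, `WilsonQCDSiteReflectionPositivityAP_holds`). The single-layer sign twist of `wilsonDiracAP` is `U(1)`-gauge
equivalent to the UNIFORM twist `U₀ ↦ e^{iπ/N_t} U₀` on every temporal link, an operator perturbation of norm `≤ 2π/N_t`; so
(Weyl, opNorm form) the spectral index and the window counts of `Γ₅D_W` change between the two boundary conditions only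
through eigenvalues within `2π/N_t` of zero — a sub-window of the EXTINCT window `c a_k m/Z_k` as soon as
`(2L_k+1)·c a_k m/Z_k ≥ 2π`, i.e. `ℓ_k ≳ Z_k/(c m)`. Consequence: an antiperiodic SIGN defect forces a periodic sign defect or
a periodic WINDOW defect, configuration-wise. (Both lemmas sorried; M-sized; the measure side of S6 is NOT configuration-wise.) -/

/-- Weyl comparison of the spectral index across the temporal boundary condition. -/
theorem negCount_ap_sub_per_le_window {L : ℕ} [NeZero L]
    (U : GaugeConfig 4 L ↥(Matrix.specialUnitaryGroup (Fin 3) ℂ)) (μ : ℝ) :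
    |((Multiset.countP (fun z : ℂ => z.re < 0)
          (spinorLift gammaFive * wilsonDiracAP (fundamentalRep (Fin 3)) U μ 1).charpoly.roots : ℕ) : ℝ) -
      (Multiset.countP (fun z : ℂ => z.re < 0)
          (spinorLift gammaFive * wilsonDirac (fundamentalRep (Fin 3)) U μ 1).charpoly.roots : ℕ)| ≤
      (Multiset.countP (fun z : ℂ => |z.re| ≤ 2 * Real.pi / L)
          (spinorLift gammaFive * wilsonDirac (fundamentalRep (Fin 3)) U μ 1).charpoly.roots : ℕ) := by
  sorry

/-- An antiperiodic sign defect at the flavour mass forces a periodic EXTINCT defect (sign or window), configuration-wise,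
once the torus is longer than `2π Z_k/(c a_k m_f)`: the b.c. error window `2π/N_t` sits inside the coercivity window. -/
theorem apSignDefect_forces_perDefect {L : ℕ} [NeZero L]
    (U : GaugeConfig 4 L ↥(Matrix.specialUnitaryGroup (Fin 3) ℂ)) (mcrit w c : ℝ) (hw : 0 < w) (hc : 0 < c)
    (hL : 2 * Real.pi / L < c * w)
    (hneg : (fermionDet (wilsonDiracAP (fundamentalRep (Fin 3)) U (mcrit + w) 1)).re < 0) :
    1 ≤ Multiset.countP (fun z : ℂ => z.im = 0 ∧ z.re < -(mcrit + w))
          (wilsonDirac (fundamentalRep (Fin 3)) U 0 1).charpoly.roots +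
        Multiset.countP (fun z : ℂ => |z.re| < c * w)
          (spinorLift gammaFive * wilsonDirac (fundamentalRep (Fin 3)) U (mcrit + w) 1).charpoly.roots := by
  sorry


end

end Summit.QuantumFields.QCD.Cruxes.ExtinctionBuildsQCD.Ideator2R1
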